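import Literature.Computability.Complexity.GateEliminationXorMap
import Literature.Computability.Complexity.GateEliminationAffineGates
import Literature.Computability.Complexity.GateEliminationTransfer
import Literature.Computability.Complexity.GateEliminationCase1
import Mathlib.Algebra.Module.ZMod

/-!
# Gate elimination: re-synthesis of the xor-part around a constant gate (Case 0.3, cyclic part)

Li–Yang's Case 0.3 (ECCC TR21-023, §4.1): "if there is a gate `G` outputing a fixed constant `c`
for any assignment to the variables, we directly replace it by `c` … a gate is removed while
`ΔΦ ≤ 2`, which means that `Δμ ≥ 1 - 2α_φ ≥ 0`." For a gate of the *cyclic* xor-part, deleting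
the gate and its equation can destroy fairness (the equation of `G` may be the one pinning other
gates: `G₁ = G₂ ⊕ x, G₂ = G₁ ⊕ G₃, G₃ = G₂ ⊕ c` is fair with `G₁ ≡ c`, but `{G₂ = c ⊕ G₃,
G₃ = G₂ ⊕ c}` is not). The correct operation keeps the information of all `|K|` equations with
`G := c` substituted — a system of full column rank `|K| - 1` in the remaining unknowns —, drops
one *redundant* equation `i`, and re-orients each remaining equation `e` to define a distinct
unknown `π(e)` occurring an odd number of times in it (a nonzero term of the determinant); since
a ⊕-type equation `s₀ = s₁ ⊕ s₂ ⊕ c_e` is symmetric in its three slots, the re-oriented gates are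
again ⊕-type with two wires. The new xor-part is fair, computes the same values, has one gate
fewer, and only the (at most two) variable wires of the dropped equation disappear, so `ΔΦ ≤ 2`
and `Δμ ≥ 1 - 2α_φ` as printed (`resynth_const_xorGate`).

## References

* J. Li, T. Yang, *3.1n − o(n) circuit lower bounds for explicit functions*, STOC 2022;
  ECCC TR21-023, §2.5 (fair cyclic xor-circuits), §4.1 (Case 0.3), Lemma 3.11.
-/

namespace Literature.Computability.Complexity

open Finset

/-! ### Linear algebra: dropping a redundant coordinate, a transversal of a nonsingular matrix -/

section LinAlg

variable {E U : Type*} [Fintype E] [Fintype U] [DecidableEq E]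

/-- If a linear map `(U → K) → (E → K)` has `card E = card U + 1`, some coordinate vector of
`E → K` is not in its range. [folklore] -/
theorem exists_single_not_mem_range {K : Type*} [Field K] (L : (U → K) →ₗ[K] (E → K))
    (hcard : Fintype.card E = Fintype.card U + 1) :
    ∃ i : E, Pi.single i (1 : K) ∉ LinearMap.range L := by
  by_contra hall
  push Not at hall
  have htop : (⊤ : Submodule K (E → K)) ≤ LinearMap.range L := by
    rw [← (Pi.basisFun K E).span_eq, Submodule.span_le]
    rintro _ ⟨i, rfl⟩
    simpa [Pi.basisFun_apply] using hall i
  have h1 : Module.finrank K (LinearMap.range L) ≤ Fintype.card U := by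
    calc Module.finrank K (LinearMap.range L) ≤ Module.finrank K (U → K) := LinearMap.finrank_range_le L
      _ = Fintype.card U := Module.finrank_fintype_fun_eq_card K
  have h2 : Module.finrank K (E → K) ≤ Module.finrank K (LinearMap.range L) := by
    have := Submodule.finrank_mono htop
    rwa [finrank_top] at this
  rw [Module.finrank_fintype_fun_eq_card] at h2
  omega

omit [Fintype E] [Fintype U] in
/-- **Dropping a coordinate that is not in the range keeps an injective linear map injective.**
[folklore] -/
theorem injective_dropCoord {K : Type*} [Field K] (L : (U → K) →ₗ[K] (E → K)) (hL : Function.Injective L)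
    {i : E} (hi : Pi.single i (1 : K) ∉ LinearMap.range L) :
    Function.Injective fun v : U → K => fun e : {e : E // e ≠ i} => L v e := by
  intro v v' h
  have hdiff : ∀ e, e ≠ i → L (v - v') e = 0 := by
    intro e he
    have := congrFun h ⟨e, he⟩
    simp only at this
    rw [map_sub, Pi.sub_apply, this, sub_self]
  set c := L (v - v') i with hc
  have hsingle : L (v - v') = c • Pi.single i (1 : K) := by
    funext e
    by_cases he : e = i
    · subst he; simp [hc]
    · rw [Pi.smul_apply, Pi.single_eq_of_ne he, smul_zero]; exact hdiff e he
  by_cases hz : c = 0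
  · rw [hz, zero_smul] at hsingle
    exact sub_eq_zero.mp (hL (by rw [hsingle, map_zero]))
  · exfalso
    apply hi
    refine ⟨c⁻¹ • (v - v'), ?_⟩
    rw [map_smul, hsingle, smul_smul, inv_mul_cancel₀ hz, one_smul]

omit [Fintype E] [DecidableEq E] in
/-- **A square matrix with injective `mulVec` has a transversal of nonzero entries** (a nonzero
term of its determinant). [folklore] -/
theorem exists_perm_apply_ne_zero [DecidableEq U] {K : Type*} [Field K] (A : Matrix U U K)
    (hA : Function.Injective A.mulVec) : ∃ σ : Equiv.Perm U, ∀ u, A (σ u) u ≠ 0 := by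
  have hunit : IsUnit A := (Matrix.mulVec_injective_iff_isUnit).mp hA
  have hdet : A.det ≠ 0 := ((Matrix.isUnit_iff_isUnit_det A).mp hunit).ne_zero
  by_contra hno
  push Not at hno
  apply hdet
  rw [Matrix.det_apply]
  refine Finset.sum_eq_zero fun σ _ => ?_
  obtain ⟨u, hu⟩ := hno σ
  exact smul_eq_zero_of_right _ (Finset.prod_eq_zero (f := fun i => A (σ i) i) (Finset.mem_univ u) hu)

/-- **An injective linear map `(U → K) → (E → K)` with `card E = card U + 1` admits a redundant
coordinate `i` and a bijective assignment of the other coordinates to the unknowns along nonzero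
matrix entries.** [folklore] -/
theorem exists_drop_and_transversal [DecidableEq U] {K : Type*} [Field K] (L : (U → K) →ₗ[K] (E → K))
    (hL : Function.Injective L) (hcard : Fintype.card E = Fintype.card U + 1) :
    ∃ (i : E) (eqn : U ≃ {e : E // e ≠ i}),
      (Function.Injective fun v : U → K => fun e : {e : E // e ≠ i} => L v e) ∧
      ∀ u, L (Pi.single u 1) (eqn u) ≠ 0 := by
  classical
  obtain ⟨i, hi⟩ := exists_single_not_mem_range L hcard
  have hinj := injective_dropCoord L hL hi
  -- a square reindexing
  have hcardS : Fintype.card {e : E // e ≠ i} = Fintype.card U := by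
    rw [Fintype.card_subtype_compl, Fintype.card_subtype_eq]; omega
  let τ : U ≃ {e : E // e ≠ i} := Fintype.equivOfCardEq hcardS.symm
  let Lsq : (U → K) →ₗ[K] (U → K) :=
    { toFun := fun v u' => L v (τ u')
      map_add' := fun v v' => by funext u'; simp
      map_smul' := fun a v => by funext u'; simp }
  have hLsq : Function.Injective Lsq := by
    intro v v' h
    apply hinj
    funext e
    have := congrFun h (τ.symm e)
    simpa [Lsq] using this
  let A := LinearMap.toMatrix' Lsq
  have hA : Function.Injective A.mulVec := by
    have : A.mulVec = Lsq := by
      funext v; exact (Matrix.toLin'_apply A v).symm.trans (by rw [Matrix.toLin'_toMatrix'])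
    rw [this]; exact hLsq
  obtain ⟨σ, hσ⟩ := exists_perm_apply_ne_zero A hA
  refine ⟨i, σ.trans τ, hinj, fun u => ?_⟩
  have := hσ u
  change LinearMap.toMatrix' Lsq (σ u) u ≠ 0 at this
  rw [LinearMap.toMatrix'_apply] at this
  exact this

end LinAlg

namespace Semicircuit

variable {n : ℕ} (C : Semicircuit n) (G : Fin C.m) (c : Bool)

/-! ### The xor-part system with `G := c` substituted -/

/-- The unknowns after substituting `G := c`: the other gates of the xor-part. [cite: LiYang2022, §2.5] -/
abbrev UIdx : Type := {u : Fin C.m // u ∈ C.xorPart ∧ u ≠ G}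

/-- Gate values from values of the unknowns: `G ↦ c`, junk `false` outside the xor-part.
[cite: LiYang2022, §4.1 (Case 0.3)] -/
def hatW (w : C.UIdx G → Bool) : Fin C.m → Bool :=
  fun k => if h : k ∈ C.xorPart ∧ k ≠ G then w ⟨k, h⟩ else if k = G then c else false

/-- The residuals of the xor-part equations as functions of the unknowns (with `G := c`).
[cite: LiYang2022, §2.5] -/
def kres (x : Fin n → Bool) (w : C.UIdx G → Bool) : C.xorPart → Bool := fun e =>
  C.hatW G c w e ^^ C.op e (C.nodeVal x (C.hatW G c w) (C.arg e 0)) (C.nodeVal x (C.hatW G c w) (C.arg e 1))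

/-- The flip of a node's value when the unknowns are flipped by `d`. [folklore] -/
def kflip (d : C.UIdx G → Bool) : Node n C.m → Bool
  | .gate k => if h : k ∈ C.xorPart ∧ k ≠ G then d ⟨k, h⟩ else false
  | _ => false

/-- **The linear part of the residual map**: equation `e` flips iff an odd number of its three
slots (its own gate, its two wires) are flipped unknowns. [cite: LiYang2022, §2.5] -/
def klin (d : C.UIdx G → Bool) : C.xorPart → Bool := fun e =>
  (C.kflip G d (.gate e) ^^ C.kflip G d (C.arg e 0)) ^^ C.kflip G d (C.arg e 1)

variable {G c}

/-- `kflip` at a gate. [folklore] -/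
theorem kflip_gate (d : C.UIdx G → Bool) (k : Fin C.m) :
    C.kflip G d (.gate k) = if h : k ∈ C.xorPart ∧ k ≠ G then d ⟨k, h⟩ else false := rfl

/-- `kflip` at a constant. [folklore] -/
theorem kflip_const (d : C.UIdx G → Bool) (b : Bool) : C.kflip G d (.const b) = false := rfl

/-- `kflip` at a variable. [folklore] -/
theorem kflip_var (d : C.UIdx G → Bool) (i : Fin n) : C.kflip G d (.var i) = false := rfl

/-- `hatW` at an unknown. [folklore] -/
theorem hatW_apply_U (w : C.UIdx G → Bool) (u : C.UIdx G) : C.hatW G c w u = w u := by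
  unfold hatW; rw [dif_pos u.2]

/-- `hatW` at `G`. [folklore] -/
theorem hatW_apply_G (w : C.UIdx G → Bool) : C.hatW G c w G = c := by
  unfold hatW; rw [dif_neg (fun h => h.2 rfl), if_pos rfl]

/-- Flipping the unknowns flips `hatW` by `kflip`. [folklore] -/
theorem hatW_xor (w d : C.UIdx G → Bool) (k : Fin C.m) :
    C.hatW G c (fun u => w u ^^ d u) k = (C.hatW G c w k ^^ C.kflip G d (.gate k)) := by
  unfold hatW
  rw [kflip_gate]
  by_cases h : k ∈ C.xorPart ∧ k ≠ G
  · rw [dif_pos h, dif_pos h, dif_pos h]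
  · rw [dif_neg h, dif_neg h, dif_neg h, Bool.xor_false]

/-- Flipping the unknowns flips node values by `kflip`. [folklore] -/
theorem nodeVal_hatW_xor (x : Fin n → Bool) (w d : C.UIdx G → Bool) (v : Node n C.m) :
    C.nodeVal x (C.hatW G c (fun u => w u ^^ d u)) v = (C.nodeVal x (C.hatW G c w) v ^^ C.kflip G d v) := by
  cases v with
  | const b => exact (Bool.xor_false _).symm
  | var i => exact (Bool.xor_false _).symm
  | gate k => exact C.hatW_xor w d k

/-- **The residual map is affine with linear part `klin`.** [cite: LiYang2022, §2.5] -/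
theorem kres_xor (x : Fin n → Bool) (w d : C.UIdx G → Bool) (e : C.xorPart) :
    C.kres G c x (fun u => w u ^^ d u) e = (C.kres G c x w e ^^ C.klin G d e) := by
  obtain ⟨ce, hce⟩ := C.isXorOp_of_mem e e.2
  unfold kres klin
  rw [hce, hce, C.nodeVal_hatW_xor, C.nodeVal_hatW_xor, C.hatW_xor]
  generalize C.hatW G c w e = p
  generalize C.kflip G d (.gate e) = q
  generalize C.nodeVal x (C.hatW G c w) (C.arg e 0) = r
  generalize C.kflip G d (C.arg e 0) = s
  generalize C.nodeVal x (C.hatW G c w) (C.arg e 1) = t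
  generalize C.kflip G d (C.arg e 1) = t'
  cases p <;> cases q <;> cases r <;> cases s <;> cases t <;> cases t' <;> cases ce <;> rfl

/-- `klin` is additive. [folklore] -/
theorem klin_xor (d d' : C.UIdx G → Bool) (e : C.xorPart) :
    C.klin G (fun u => d u ^^ d' u) e = (C.klin G d e ^^ C.klin G d' e) := by
  have hk : ∀ v, C.kflip G (fun u => d u ^^ d' u) v = (C.kflip G d v ^^ C.kflip G d' v) := by
    intro v
    cases v with
    | const b => rfl
    | var i => rfl
    | gate k =>
      rw [kflip_gate, kflip_gate, kflip_gate]
      by_cases h : k ∈ C.xorPart ∧ k ≠ G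
      · rw [dif_pos h, dif_pos h, dif_pos h]
      · rw [dif_neg h, dif_neg h, dif_neg h]; rfl
  unfold klin
  rw [hk, hk, hk]
  generalize C.kflip G d (.gate e) = p
  generalize C.kflip G d' (.gate e) = p'
  generalize C.kflip G d (C.arg e 0) = q
  generalize C.kflip G d' (C.arg e 0) = q'
  generalize C.kflip G d (C.arg e 1) = r
  generalize C.kflip G d' (C.arg e 1) = r'
  cases p <;> cases p' <;> cases q <;> cases q' <;> cases r <;> cases r' <;> rfl

/-- Zero residuals are the xor-part equations for `hatW`. [cite: LiYang2022, §2.5] -/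
theorem kres_eq_false_iff (x : Fin n → Bool) (w : C.UIdx G → Bool) :
    (∀ e, C.kres G c x w e = false) ↔ C.XorConsistent x (C.hatW G c w) := by
  constructor
  · intro h j hj
    have := h ⟨j, hj⟩
    unfold kres at this
    unfold GateEq
    revert this
    generalize C.hatW G c w j = a
    generalize C.op j _ _ = b
    cases a <;> cases b <;> simp
  · intro h ⟨j, hj⟩
    have := h j hj
    unfold GateEq at this
    unfold kres
    rw [← this]
    simp

/-! #### Solutions: existence and uniqueness from fairness and `G ≡ c` -/

/-- The solution of `C` restricted to the unknowns. [cite: LiYang2022, §2.5] -/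
noncomputable def ksol (hF : C.Fair) (x : Fin n → Bool) : C.UIdx G → Bool := fun u => C.sol hF x u

/-- The solution has zero residuals (since `G ≡ c`). [cite: LiYang2022, §4.1 (Case 0.3)] -/
theorem kres_ksol (hF : C.Fair) (hconst : ∀ (x : Fin n → Bool) (w : Fin C.m → Bool), C.Consistent x w → w G = c)
    (x : Fin n → Bool) (e : C.xorPart) : C.kres G c x (C.ksol hF x) e = false := by
  revert e
  rw [C.kres_eq_false_iff]
  have hK : ∀ j ∈ C.xorPart, C.hatW G c (C.ksol hF x) j = C.sol hF x j := by
    intro j hj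
    unfold hatW ksol
    by_cases h : j ∈ C.xorPart ∧ j ≠ G
    · rw [dif_pos h]
    · have hjG : j = G := by
        by_contra hne; exact h ⟨hj, hne⟩
      rw [dif_neg h, if_pos hjG, hjG]
      exact (hconst x _ (C.consistent_sol hF x)).symm
  exact (consistent_iff_xor_acyclic.mp (C.consistent_sol hF x)).1.congr hK

/-- **Uniqueness of the zero of the residual map.** [cite: LiYang2022, §2.5] -/
theorem eq_ksol_of_kres (hF : C.Fair) {x : Fin n → Bool} {w : C.UIdx G → Bool} (hw : ∀ e, C.kres G c x w e = false) :
    w = C.ksol hF x := by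
  rw [C.kres_eq_false_iff] at hw
  obtain ⟨W, hW, hWK⟩ := hw.exists_consistent
  have hWsol := hW.eq_sol hF
  funext u
  have := hWK u u.2.1
  rw [C.hatW_apply_U] at this
  rw [← this, hWsol]
  rfl

/-- **The linear part is injective**: a flip with no effect on the residuals is trivial.
[cite: LiYang2022, §2.5] -/
theorem klin_injective (hF : C.Fair) (hconst : ∀ (x : Fin n → Bool) (w : Fin C.m → Bool), C.Consistent x w → w G = c)
    {d : C.UIdx G → Bool} (hd : ∀ e, C.klin G d e = false) : ∀ u, d u = false := by
  let x : Fin n → Bool := fun _ => false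
  have h1 : ∀ e, C.kres G c x (fun u => C.ksol hF x u ^^ d u) e = false := by
    intro e; rw [C.kres_xor, hd, C.kres_ksol hF hconst, Bool.xor_false]
  have h2 := C.eq_ksol_of_kres hF h1
  intro u
  have := congrFun h2 u
  change (C.ksol hF x u ^^ d u) = C.ksol hF x u at this
  revert this; cases C.ksol hF x u <;> cases d u <;> simp

/-! #### The linear part over `𝔽₂` and the orientation of the equations -/

/-- The linear part as an additive map over `𝔽₂`. [folklore] -/
noncomputable def klinAdd : (C.UIdx G → ZMod 2) →+ (C.xorPart → ZMod 2) where
  toFun v e := boolToZMod2 (C.klin G (fun u => finTwoEquiv (v u)) e)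
  map_zero' := by
    funext e
    have h0 : (fun u => finTwoEquiv ((0 : C.UIdx G → ZMod 2) u)) = fun _ => false := by funext u; rfl
    have : ∀ e', C.klin G (fun _ => false) e' = false := by
      intro e'
      have hk : ∀ v, C.kflip G (fun _ => false) v = false := by
        intro v; cases v with
        | const b => rfl
        | var i => rfl
        | gate k => rw [kflip_gate]; split_ifs <;> rfl
      unfold klin; rw [hk, hk, hk]; rfl
    show boolToZMod2 (C.klin G (fun u => finTwoEquiv ((0 : C.UIdx G → ZMod 2) u)) e) = 0
    rw [h0, this]; rfl
  map_add' v v' := by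
    funext e
    rw [Pi.add_apply]
    have : (fun u => finTwoEquiv ((v + v') u)) = fun u => (finTwoEquiv (v u) ^^ finTwoEquiv (v' u)) := by
      funext u; rw [Pi.add_apply, finTwoEquiv_add]
    show boolToZMod2 (C.klin G (fun u => finTwoEquiv ((v + v') u)) e) = _
    rw [this, C.klin_xor, boolToZMod2_xor]

/-- The linear part as an `𝔽₂`-linear map. [folklore] -/
noncomputable def klinZ : (C.UIdx G → ZMod 2) →ₗ[ZMod 2] (C.xorPart → ZMod 2) :=
  AddMonoidHom.toZModLinearMap 2 (C.klinAdd (G := G))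

/-- `klinZ` evaluated. [folklore] -/
theorem klinZ_apply (v : C.UIdx G → ZMod 2) (e : C.xorPart) :
    C.klinZ (G := G) v e = boolToZMod2 (C.klin G (fun u => finTwoEquiv (v u)) e) := rfl

/-- `klinZ` on a coordinate vector, read in `Bool`: the flip of a single unknown. [folklore] -/
theorem klinZ_single_ne_zero_iff (u : C.UIdx G) (e : C.xorPart) :
    C.klinZ (G := G) (Pi.single u 1) e ≠ 0 ↔ C.klin G (fun u' => decide (u' = u)) e = true := by
  rw [klinZ_apply]
  have : (fun u' => finTwoEquiv ((Pi.single u (1 : ZMod 2) : C.UIdx G → ZMod 2) u')) = fun u' => decide (u' = u) := by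
    funext u'
    by_cases h : u' = u
    · subst h; rw [Pi.single_eq_same, decide_eq_true rfl]; rfl
    · rw [Pi.single_eq_of_ne h, decide_eq_false h]; rfl
  rw [this]
  cases C.klin G (fun u' => decide (u' = u)) e <;> simp [boolToZMod2]

/-- `klinZ` is injective. [cite: LiYang2022, §2.5] -/
theorem klinZ_injective (hF : C.Fair) (hconst : ∀ (x : Fin n → Bool) (w : Fin C.m → Bool), C.Consistent x w → w G = c) :
    Function.Injective (C.klinZ (G := G)) := by
  refine (injective_iff_map_eq_zero _).mpr fun v hv => ?_
  have hd : ∀ e, C.klin G (fun u => finTwoEquiv (v u)) e = false := by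
    intro e
    have := congrFun hv e
    rw [klinZ_apply] at this
    change boolToZMod2 (C.klin G (fun u => finTwoEquiv (v u)) e) = 0 at this
    revert this; cases C.klin G (fun u => finTwoEquiv (v u)) e <;> simp [boolToZMod2]
  have h0 := C.klin_injective hF hconst hd
  funext u
  have := h0 u
  have hv : v u = finTwoEquiv.symm (finTwoEquiv (v u)) := (finTwoEquiv.symm_apply_apply _).symm
  rw [hv, this]; rfl

/-- The number of gates of the xor-part other than `G`. [folklore] -/
theorem card_UIdx (hG : G ∈ C.xorPart) : Fintype.card C.xorPart = Fintype.card (C.UIdx G) + 1 := by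
  classical
  have h1 : Fintype.card (C.UIdx G) = (C.xorPart.erase G).card := by
    rw [← Fintype.card_coe]
    refine Fintype.card_congr (Equiv.subtypeEquiv (Equiv.refl _) fun u => ?_)
    simp [mem_erase, and_comm]
  rw [h1, Fintype.card_coe, card_erase_add_one hG]

/-- **Orientation of the substituted xor-part system**: a redundant equation `i` and a bijective
assignment `eqn` of the other equations to the unknowns, each unknown occurring an odd number of
times in its equation; dropping `i` keeps the zero of the residual map unique. [cite: LiYang2022, §2.5, §4.1 (Case 0.3)] -/
theorem exists_orientation (hF : C.Fair) (hG : G ∈ C.xorPart)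
    (hconst : ∀ (x : Fin n → Bool) (w : Fin C.m → Bool), C.Consistent x w → w G = c) :
    ∃ (i : C.xorPart) (eqn : C.UIdx G ≃ {e : C.xorPart // e ≠ i}),
      (∀ (x : Fin n → Bool) (w : C.UIdx G → Bool), (∀ e : C.xorPart, e ≠ i → C.kres G c x w e = false) → w = C.ksol hF x) ∧
      ∀ u, C.klin G (fun u' => decide (u' = u)) (eqn u) = true := by
  classical
  obtain ⟨i, eqn, hinj, hodd⟩ := exists_drop_and_transversal (C.klinZ (G := G)) (C.klinZ_injective hF hconst)
    (C.card_UIdx hG)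
  refine ⟨i, eqn, fun x w hw => ?_, fun u => (C.klinZ_single_ne_zero_iff u _).mp (hodd u)⟩
  -- `w ⊕ ksol` is a flip invisible away from `i`
  let d : C.UIdx G → Bool := fun u => w u ^^ C.ksol hF x u
  have hd : ∀ e : C.xorPart, e ≠ i → C.klin G d e = false := by
    intro e he
    have h1 : C.kres G c x (fun u => C.ksol hF x u ^^ d u) e = false := by
      have : (fun u => C.ksol hF x u ^^ d u) = w := by
        funext u; show (C.ksol hF x u ^^ (w u ^^ C.ksol hF x u)) = w u
        cases C.ksol hF x u <;> cases w u <;> rfl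
      rw [this]; exact hw e he
    rw [C.kres_xor, C.kres_ksol hF hconst, Bool.false_xor] at h1
    exact h1
  -- hence zero in `𝔽₂` away from `i`, hence `d = 0` by injectivity of the dropped map
  let v : C.UIdx G → ZMod 2 := fun u => boolToZMod2 (d u)
  have hv : (fun e : {e : C.xorPart // e ≠ i} => C.klinZ (G := G) v e) =
      fun e : {e : C.xorPart // e ≠ i} => C.klinZ (G := G) 0 e := by
    funext e
    rw [map_zero, Pi.zero_apply, klinZ_apply]
    change boolToZMod2 (C.klin G (fun u => finTwoEquiv (boolToZMod2 (d u))) e) = 0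
    have : (fun u => finTwoEquiv (boolToZMod2 (d u))) = d := by
      funext u; cases d u <;> rfl
    rw [this, hd e e.2]; rfl
  have hv0 : v = 0 := hinj hv
  funext u
  have := congrFun hv0 u
  change boolToZMod2 (w u ^^ C.ksol hF x u) = 0 at this
  revert this; cases w u <;> cases C.ksol hF x u <;> simp [boolToZMod2]

/-! ### Substituting the constant for `G` in the wires -/

/-- Replace the wire `G` by the constant `c`. [cite: LiYang2022, §4.1 (Case 0.3)] -/
def substG (G : Fin C.m) (c : Bool) : Node n C.m → Node n C.m
  | .gate k => if k = G then .const c else .gate k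
  | v => v

/-- `substG` on a gate other than `G`. [folklore] -/
theorem substG_gate_of_ne {k : Fin C.m} (h : k ≠ G) : C.substG G c (.gate k) = .gate k := by
  show (if k = G then Node.const c else .gate k) = _; rw [if_neg h]

/-- `substG` on `G`. [folklore] -/
theorem substG_gate_self : C.substG G c (.gate G) = .const c := by
  show (if G = G then Node.const c else .gate G) = _; rw [if_pos rfl]

/-- `substG` never yields `G`. [folklore] -/
theorem substG_ne_gate (v : Node n C.m) : C.substG G c v ≠ .gate G := by
  cases v with
  | const b => exact fun h => by cases h
  | var i => exact fun h => by cases h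
  | gate k =>
    by_cases hk : k = G
    · rw [hk, substG_gate_self]; exact fun h => by cases h
    · rw [C.substG_gate_of_ne hk]; exact fun h => hk (Node.gate.inj h)

/-- `substG` yields the gate `k ≠ G` iff the node was that gate. [folklore] -/
theorem substG_eq_gate_iff {v : Node n C.m} {k : Fin C.m} (hk : k ≠ G) : C.substG G c v = .gate k ↔ v = .gate k := by
  cases v with
  | const b => exact ⟨(fun h => by cases h), fun h => by cases h⟩
  | var i => exact ⟨(fun h => by cases h), fun h => by cases h⟩
  | gate k' =>
    by_cases hk' : k' = G
    · rw [hk', substG_gate_self]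
      exact ⟨(fun h => by cases h), fun h => absurd (Node.gate.inj h).symm hk⟩
    · rw [C.substG_gate_of_ne hk']

/-- `substG` yields the variable `x_j` iff the node was that variable. [folklore] -/
theorem substG_eq_var_iff {v : Node n C.m} {j : Fin n} : C.substG G c v = .var j ↔ v = .var j := by
  cases v with
  | const b => exact ⟨(fun h => by cases h), fun h => by cases h⟩
  | var i => exact Iff.rfl
  | gate k' =>
    by_cases hk' : k' = G
    · rw [hk', substG_gate_self]; exact ⟨(fun h => by cases h), fun h => by cases h⟩
    · rw [C.substG_gate_of_ne hk']

/-- Node values after `substG`, when `G` has the value `c`. [folklore] -/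
theorem nodeVal_substG (x : Fin n → Bool) {W : Fin C.m → Bool} (hW : W G = c) (v : Node n C.m) :
    C.nodeVal x W (C.substG G c v) = C.nodeVal x W v := by
  cases v with
  | const b => rfl
  | var i => rfl
  | gate k =>
    by_cases hk : k = G
    · rw [hk, substG_gate_self]; exact hW.symm
    · rw [C.substG_gate_of_ne hk]

/-! ### Orienting an equation towards an unknown -/

section Orient

variable {i : C.xorPart} (eqn : C.UIdx G ≃ {e : C.xorPart // e ≠ i})

/-- The equation defining the unknown `u` after re-orientation: its index in the xor-part. [folklore] -/
abbrev eqnOf (u : C.UIdx G) : Fin C.m := ((eqn u).1 : Fin C.m)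

/-- **The new wires of the unknown `u`**: the two slots of its equation other than one occurrence
of `u` itself (the equation `s₀ = s₁ ⊕ s₂ ⊕ c_e` is symmetric in `s₀, s₁, s₂`). [cite: LiYang2022, §4.1 (Case 0.3)] -/
def orientWires (u : C.UIdx G) : Fin 2 → Node n C.m :=
  if C.eqnOf eqn u = u then fun a => C.arg (C.eqnOf eqn u) a
  else if C.arg (C.eqnOf eqn u) 0 = .gate u then fun a => if a = 0 then .gate (C.eqnOf eqn u) else C.arg (C.eqnOf eqn u) 1
  else fun a => if a = 0 then .gate (C.eqnOf eqn u) else C.arg (C.eqnOf eqn u) 0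

/-- The constant of the equation of `u`. [folklore] -/
def orientConst (u : C.UIdx G) : Bool := C.op (C.eqnOf eqn u) false false

/-- `kflip` of a single unknown is the indicator of that gate. [folklore] -/
theorem kflip_single (u : C.UIdx G) (v : Node n C.m) :
    C.kflip G (fun u' => decide (u' = u)) v = decide (v = .gate (u : Fin C.m)) := by
  cases v with
  | const b => exact (decide_eq_false fun h => by cases h).symm
  | var j => exact (decide_eq_false fun h => by cases h).symm
  | gate k =>
    rw [kflip_gate]
    by_cases h : k ∈ C.xorPart ∧ k ≠ G
    · rw [dif_pos h]
      by_cases hk : k = u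
      · rw [decide_eq_true (Subtype.ext hk), decide_eq_true (congrArg Node.gate hk)]
      · rw [decide_eq_false (fun h' => hk (congrArg Subtype.val h')), decide_eq_false (fun h' => hk (Node.gate.inj h'))]
    · rw [dif_neg h, decide_eq_false]
      intro h'
      have hk := Node.gate.inj h'
      exact h (hk ▸ u.2)

variable (hodd : ∀ u, C.klin G (fun u' => decide (u' = u)) (eqn u) = true)
include hodd

/-- The third slot holds `u` when the first two do not. [folklore] -/
theorem arg_one_eq_of_odd (u : C.UIdx G) (h0 : C.eqnOf eqn u ≠ u) (h1 : C.arg (C.eqnOf eqn u) 0 ≠ .gate u) :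
    C.arg (C.eqnOf eqn u) 1 = .gate u := by
  have := hodd u
  unfold klin at this
  rw [kflip_single, kflip_single, kflip_single, decide_eq_false (fun h => h0 (Node.gate.inj h)), decide_eq_false h1] at this
  simpa using this

/-- **The re-oriented equation is equivalent to the original one.** [cite: LiYang2022, §2.5] -/
theorem orient_iff (u : C.UIdx G) (x : Fin n → Bool) (W : Fin C.m → Bool) :
    W u = ((C.nodeVal x W (C.orientWires eqn u 0) ^^ C.nodeVal x W (C.orientWires eqn u 1)) ^^ C.orientConst eqn u) ↔
      C.GateEq x W (C.eqnOf eqn u) := by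
  obtain ⟨ce, hce⟩ := C.isXorOp_of_mem (C.eqnOf eqn u) (eqn u).1.2
  have hconst : C.orientConst eqn u = ce := by unfold orientConst; rw [hce]; cases ce <;> rfl
  unfold GateEq orientWires
  rw [hconst, hce]
  by_cases h0 : C.eqnOf eqn u = u
  · rw [if_pos h0, h0]
  · rw [if_neg h0]
    by_cases h1 : C.arg (C.eqnOf eqn u) 0 = .gate u
    · rw [if_pos h1, if_pos rfl, if_neg (by decide), h1]
      show W u = ((W (C.eqnOf eqn u) ^^ _) ^^ ce) ↔ W (C.eqnOf eqn u) = ((W u ^^ _) ^^ ce)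
      generalize W u = p
      generalize W (C.eqnOf eqn u) = q
      generalize C.nodeVal x W (C.arg (C.eqnOf eqn u) 1) = r
      cases p <;> cases q <;> cases r <;> cases ce <;> decide
    · have h2 := C.arg_one_eq_of_odd eqn hodd u h0 h1
      rw [if_neg h1, if_pos rfl, if_neg (by decide), h2]
      show W u = ((W (C.eqnOf eqn u) ^^ _) ^^ ce) ↔ W (C.eqnOf eqn u) = ((_ ^^ W u) ^^ ce)
      generalize W u = p
      generalize W (C.eqnOf eqn u) = q
      generalize C.nodeVal x W (C.arg (C.eqnOf eqn u) 0) = r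
      cases p <;> cases q <;> cases r <;> cases ce <;> decide

omit hodd in
/-- The new wires are slots of the equation: the equation's gate or one of its wires. [folklore] -/
theorem orientWires_mem (u : C.UIdx G) (a : Fin 2) :
    C.orientWires eqn u a = .gate (C.eqnOf eqn u) ∨ ∃ a', C.orientWires eqn u a = C.arg (C.eqnOf eqn u) a' := by
  unfold orientWires
  split_ifs with h0 h1
  · exact Or.inr ⟨a, rfl⟩
  · by_cases ha : a = 0
    · left; beta_reduce; rw [if_pos ha]
    · right; exact ⟨1, by beta_reduce; rw [if_neg ha]⟩
  · by_cases ha : a = 0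
    · left; beta_reduce; rw [if_pos ha]
    · right; exact ⟨0, by beta_reduce; rw [if_neg ha]⟩

/-- **Counting the new wires to a node that is not a gate of the xor-part**: as many as the
wires of the equation to it (the removed slot and the equation's own slot are xor-part gates).
[folklore] -/
theorem card_orientWires_eq (u : C.UIdx G) {v : Node n C.m} (hv : ∀ k ∈ C.xorPart, v ≠ .gate k) :
    (univ.filter fun a : Fin 2 => C.orientWires eqn u a = v).card =
      (univ.filter fun a : Fin 2 => C.arg (C.eqnOf eqn u) a = v).card := by
  have hve : v ≠ .gate (C.eqnOf eqn u) := hv _ (eqn u).1.2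
  have hvu : v ≠ .gate (u : Fin C.m) := hv _ u.2.1
  unfold orientWires
  by_cases h0 : C.eqnOf eqn u = u
  · rw [if_pos h0]
  · rw [if_neg h0]
    by_cases h1 : C.arg (C.eqnOf eqn u) 0 = .gate u
    · rw [if_pos h1]
      simp only [card_filter, Fin.sum_univ_two, if_true, show ¬ ((1 : Fin 2) = 0) from by decide, if_false]
      rw [if_neg hve.symm, h1, if_neg hvu.symm]
    · have h2 := C.arg_one_eq_of_odd eqn hodd u h0 h1
      rw [if_neg h1]
      simp only [card_filter, Fin.sum_univ_two, if_true, show ¬ ((1 : Fin 2) = 0) from by decide, if_false]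
      rw [if_neg hve.symm, h2, if_neg hvu.symm, zero_add, add_zero]

end Orient

/-! ### The re-oriented circuit (same gates; `G` turned into an unread dummy) -/

section Reorient

variable (c)
variable {i : C.xorPart} (eqn : C.UIdx G ≃ {e : C.xorPart // e ≠ i}) (hG : G ∈ C.xorPart)

/-- **The re-oriented circuit**: every gate `u ≠ G` of the xor-part is defined by its assigned
equation (re-oriented, with `G ↦ c` in the wires); `G` becomes the unread ⊕-gate `c ⊕ 0`; the
acyclic part only sees `G ↦ c`. [cite: LiYang2022, §4.1 (Case 0.3)] -/
abbrev reorient : Semicircuit n where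
  m := C.m
  op k := if hkG : k = G then (fun p q => p ^^ q)
    else if hk : k ∈ C.xorPart then (fun p q => (p ^^ q) ^^ C.orientConst eqn ⟨k, hk, hkG⟩) else C.op k
  arg k a := if hkG : k = G then (if a = 0 then .const c else .const false)
    else if hk : k ∈ C.xorPart then C.substG G c (C.orientWires eqn ⟨k, hk, hkG⟩ a) else C.substG G c (C.arg k a)
  out := C.out
  xorPart := C.xorPart
  isXorOp_of_mem k hk := by
    by_cases hkG : k = G
    · rw [dif_pos hkG]; exact ⟨false, fun a b => (Bool.xor_false _).symm⟩
    · rw [dif_neg hkG, dif_pos hk]; exact ⟨_, fun a b => rfl⟩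
  mem_of_arg_eq k hk a k' h := by
    by_cases hkG : k = G
    · rw [dif_pos hkG] at h; split_ifs at h
    · rw [dif_neg hkG, dif_pos hk] at h
      have hk'G : k' ≠ G := by intro h'; rw [h'] at h; exact C.substG_ne_gate _ h
      rw [C.substG_eq_gate_iff hk'G] at h
      rcases C.orientWires_mem eqn ⟨k, hk, hkG⟩ a with h' | ⟨a', h'⟩
      · rw [h'] at h; cases h; exact (eqn ⟨k, hk, hkG⟩).1.2
      · rw [h'] at h; exact C.mem_of_arg_eq _ (eqn ⟨k, hk, hkG⟩).1.2 a' k' h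
  acyclic := by
    obtain ⟨ρ, hρ⟩ := C.acyclic
    refine ⟨ρ, fun k hk a k' h hk' => ?_⟩
    have hkG : k ≠ G := fun h' => hk (h' ▸ hG)
    rw [dif_neg hkG, dif_neg hk] at h
    have hk'G : k' ≠ G := fun h' => hk' (h' ▸ hG)
    rw [C.substG_eq_gate_iff hk'G] at h
    exact hρ k hk a k' h hk'

/-- Wires of `G` in the re-oriented circuit: constants. [folklore] -/
theorem reorient_arg_G (a : Fin 2) : ∃ b, (C.reorient c eqn hG).arg G a = .const b := by
  show ∃ b, (if hkG : G = G then (if a = 0 then Node.const c else .const false) else _) = Node.const b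
  rw [dif_pos rfl]; split_ifs <;> exact ⟨_, rfl⟩

/-- Wires of `G` in the re-oriented circuit, position `0`. [folklore] -/
theorem reorient_arg_G0 : (C.reorient c eqn hG).arg G 0 = .const c := by
  show (if hkG : G = G then (if (0 : Fin 2) = 0 then Node.const c else .const false) else _) = _
  rw [dif_pos rfl, if_pos rfl]

/-- Wires of `G` in the re-oriented circuit, position `1`. [folklore] -/
theorem reorient_arg_G1 : (C.reorient c eqn hG).arg G 1 = .const false := by
  show (if hkG : G = G then (if (1 : Fin 2) = 0 then Node.const c else .const false) else _) = _
  rw [dif_pos rfl, if_neg (by decide)]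

/-- The function of `G` in the re-oriented circuit. [folklore] -/
theorem reorient_op_G : (C.reorient c eqn hG).op G = fun p q => p ^^ q := by
  show (if hkG : G = G then _ else _) = _
  rw [dif_pos rfl]

/-- Wires of an unknown in the re-oriented circuit. [folklore] -/
theorem reorient_arg_U {k : Fin C.m} (hk : k ∈ C.xorPart) (hkG : k ≠ G) (a : Fin 2) :
    (C.reorient c eqn hG).arg k a = C.substG G c (C.orientWires eqn ⟨k, hk, hkG⟩ a) := by
  show (if hkG : k = G then _ else _) = _
  rw [dif_neg hkG, dif_pos hk]

/-- The function of an unknown in the re-oriented circuit. [folklore] -/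
theorem reorient_op_U {k : Fin C.m} (hk : k ∈ C.xorPart) (hkG : k ≠ G) :
    (C.reorient c eqn hG).op k = fun p q => (p ^^ q) ^^ C.orientConst eqn ⟨k, hk, hkG⟩ := by
  show (if hkG : k = G then _ else _) = _
  rw [dif_neg hkG, dif_pos hk]

/-- The function of a gate of the acyclic part in the re-oriented circuit. [folklore] -/
theorem reorient_op_A {k : Fin C.m} (hk : k ∉ C.xorPart) :
    (C.reorient c eqn hG).op k = C.op k := by
  have hkG : k ≠ G := fun h' => hk (h' ▸ hG)
  show (if hkG : k = G then _ else _) = _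
  rw [dif_neg hkG, dif_neg hk]

/-- Wires of a gate of the acyclic part in the re-oriented circuit. [folklore] -/
theorem reorient_arg_A {k : Fin C.m} (hk : k ∉ C.xorPart) (a : Fin 2) :
    (C.reorient c eqn hG).arg k a = C.substG G c (C.arg k a) := by
  have hkG : k ≠ G := fun h' => hk (h' ▸ hG)
  show (if hkG : k = G then _ else _) = _
  rw [dif_neg hkG, dif_neg hk]

/-- No gate of the re-oriented circuit reads `G`. [folklore] -/
theorem reorient_not_reads : ∀ k a, (C.reorient c eqn hG).arg k a ≠ .gate G := by
  intro k a
  by_cases hkG : k = G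
  · rw [hkG]; obtain ⟨b, hb⟩ := C.reorient_arg_G c eqn hG a; rw [hb]; exact fun h => by cases h
  · by_cases hk : k ∈ C.xorPart
    · rw [C.reorient_arg_U c eqn hG hk hkG]; exact C.substG_ne_gate _
    · rw [C.reorient_arg_A c eqn hG hk]; exact C.substG_ne_gate _

variable (hF : C.Fair) (hconst : ∀ (x : Fin n → Bool) (w : Fin C.m → Bool), C.Consistent x w → w G = c)
  (huniq : ∀ (x : Fin n → Bool) (w : C.UIdx G → Bool), (∀ e : C.xorPart, e ≠ i → C.kres G c x w e = false) → w = C.ksol hF x)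
  (hodd : ∀ u, C.klin G (fun u' => decide (u' = u)) (eqn u) = true)

include hconst huniq hodd in
/-- **The re-oriented circuit has the same solutions as `C`.** [cite: LiYang2022, §2.5, §4.1 (Case 0.3)] -/
theorem consistent_reorient_iff (x : Fin n → Bool) (W : Fin C.m → Bool) :
    (C.reorient c eqn hG).Consistent x W ↔ C.Consistent x W := by
  -- the equation of `G` in the new circuit pins `W G = c`
  have hGeq : (C.reorient c eqn hG).GateEq x W G ↔ W G = c := by
    unfold GateEq
    rw [C.reorient_op_G, C.reorient_arg_G0, C.reorient_arg_G1]
    show W G = (c ^^ false) ↔ _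
    rw [Bool.xor_false]
  -- the equations of the unknowns are the re-oriented old equations (given `W G = c`)
  have hUeq : W G = c → ∀ u : C.UIdx G, (C.reorient c eqn hG).GateEq x W u ↔ C.GateEq x W (C.eqnOf eqn u) := by
    intro hWG u
    rw [← C.orient_iff eqn hodd u x W]
    unfold GateEq
    rw [C.reorient_arg_U c eqn hG u.2.1 u.2.2, C.reorient_arg_U c eqn hG u.2.1 u.2.2, C.reorient_op_U c eqn hG u.2.1 u.2.2]
    show W u = (((C.reorient c eqn hG).nodeVal x W _ ^^ (C.reorient c eqn hG).nodeVal x W _) ^^ _) ↔ _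
    rw [show ∀ v, (C.reorient c eqn hG).nodeVal x W v = C.nodeVal x W v from fun v => by cases v <;> rfl,
      show ∀ v, (C.reorient c eqn hG).nodeVal x W v = C.nodeVal x W v from fun v => by cases v <;> rfl,
      C.nodeVal_substG x hWG, C.nodeVal_substG x hWG]
  -- the acyclic equations are unchanged (given `W G = c`)
  have hAeq : W G = c → ∀ k, k ∉ C.xorPart → ((C.reorient c eqn hG).GateEq x W k ↔ C.GateEq x W k) := by
    intro hWG k hk
    have hkG : k ≠ G := fun h' => hk (h' ▸ hG)
    unfold GateEq
    rw [C.reorient_arg_A c eqn hG hk, C.reorient_arg_A c eqn hG hk, C.reorient_op_A c eqn hG hk]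
    rw [show ∀ v, (C.reorient c eqn hG).nodeVal x W v = C.nodeVal x W v from fun v => by cases v <;> rfl,
      show ∀ v, (C.reorient c eqn hG).nodeVal x W v = C.nodeVal x W v from fun v => by cases v <;> rfl,
      C.nodeVal_substG x hWG, C.nodeVal_substG x hWG]
  constructor
  · intro hW
    have hWG : W G = c := hGeq.mp (hW G)
    -- the unknowns solve all equations but `i`, hence equal the solution of `C`
    let w : C.UIdx G → Bool := fun u => W u
    have hhat : ∀ j ∈ C.xorPart, C.hatW G c w j = W j := by
      intro j hj
      unfold hatW
      by_cases h : j ∈ C.xorPart ∧ j ≠ G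
      · rw [dif_pos h]
      · have hjG : j = G := by by_contra hne; exact h ⟨hj, hne⟩
        rw [dif_neg h, if_pos hjG, hjG, hWG]
    have hkres : ∀ e : C.xorPart, e ≠ i → C.kres G c x w e = false := by
      intro e he
      -- `e = eqn u` for `u = eqn.symm ⟨e, he⟩`
      have hu : C.eqnOf eqn (eqn.symm ⟨e, he⟩) = e := by
        show (((eqn (eqn.symm ⟨e, he⟩)).1 : Fin C.m)) = e; rw [Equiv.apply_symm_apply]
      have hE : C.GateEq x W e := by rw [← hu]; exact (hUeq hWG _).mp (hW _)
      have hE' : C.GateEq x (C.hatW G c w) e := by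
        have hX : C.XorConsistent x W → C.XorConsistent x (C.hatW G c w) := fun h => h.congr hhat
        -- transfer one equation: it reads only xor-part values
        unfold GateEq at hE ⊢
        rw [hhat e e.2]
        have hval : ∀ a, C.nodeVal x (C.hatW G c w) (C.arg e a) = C.nodeVal x W (C.arg e a) := by
          intro a
          cases h : C.arg e a with
          | const b => rfl
          | var j => rfl
          | gate k => exact hhat k (C.mem_of_arg_eq e e.2 a k h)
        rw [hval, hval]; exact hE
      unfold kres
      unfold GateEq at hE'
      rw [← hE']; simp
    have hw := huniq x w hkres
    -- so `W` agrees with the solution of `C` on the xor-part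
    have hWK : ∀ j ∈ C.xorPart, W j = C.sol hF x j := by
      intro j hj
      by_cases hjG : j = G
      · rw [hjG, hWG]; exact (hconst x _ (C.consistent_sol hF x)).symm
      · have := congrFun hw ⟨j, hj, hjG⟩
        exact this
    have hXor : C.XorConsistent x W :=
      (consistent_iff_xor_acyclic.mp (C.consistent_sol hF x)).1.congr fun j hj => hWK j hj
    refine consistent_iff_xor_acyclic.mpr ⟨hXor, fun k hk => (hAeq hWG k hk).mp (hW k)⟩
  · intro hW
    have hWG : W G = c := hconst x W hW
    intro k
    by_cases hkG : k = G
    · rw [hkG]; exact hGeq.mpr hWG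
    · by_cases hk : k ∈ C.xorPart
      · exact (hUeq hWG ⟨k, hk, hkG⟩).mpr (hW _)
      · exact (hAeq hWG k hk).mpr (hW k)

include hconst huniq hodd in
/-- The re-oriented circuit is fair. [cite: LiYang2022, §2.5] -/
theorem fair_reorient : (C.reorient c eqn hG).Fair := fun x => by
  obtain ⟨w, hw, hu⟩ := hF x
  exact ⟨w, (C.consistent_reorient_iff c eqn hG hF hconst huniq hodd x w).mpr hw,
    fun w' hw' => hu w' ((C.consistent_reorient_iff c eqn hG hF hconst huniq hodd x w').mp hw')⟩

/-- **Out-degrees in the re-oriented circuit**: a variable or a gate of the acyclic part loses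
exactly the wires of the dropped equation `i`. [cite: LiYang2022, §4.1 (Case 0.3)] -/
theorem fanout_reorient_add (hodd : ∀ u, C.klin G (fun u' => decide (u' = u)) (eqn u) = true)
    {v : Node n C.m} (hv : ∀ k ∈ C.xorPart, v ≠ .gate k) (hvc : ∀ b, v ≠ .const b) :
    (C.reorient c eqn hG).fanout v + (univ.filter fun a : Fin 2 => C.arg i a = v).card = C.fanout v := by
  classical
  unfold fanout
  -- gate by gate: `G` contributes nothing; acyclic gates the same; unknown `u` the wires of `eqn u`
  have hvG : v ≠ .gate G := hv G hG
  have hsub : ∀ w : Node n C.m, C.substG G c w = v ↔ w = v := by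
    intro w
    cases w with
    | const b => exact Iff.rfl
    | var j => exact Iff.rfl
    | gate k =>
      by_cases hk : k = G
      · rw [hk, substG_gate_self]
        exact ⟨fun h => absurd h.symm (hvc c), fun h => absurd h.symm hvG⟩
      · rw [C.substG_gate_of_ne hk]
  have hterm : ∀ k : Fin C.m, (univ.filter fun a : Fin 2 => (C.reorient c eqn hG).arg k a = v).card =
      if hkG : k = G then 0 else if hk : k ∈ C.xorPart then
        (univ.filter fun a : Fin 2 => C.arg (C.eqnOf eqn ⟨k, hk, hkG⟩) a = v).card
      else (univ.filter fun a : Fin 2 => C.arg k a = v).card := by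
    intro k
    by_cases hkG : k = G
    · rw [dif_pos hkG, card_eq_zero, filter_eq_empty_iff]
      intro a _ h
      subst hkG
      obtain ⟨b, hb⟩ := C.reorient_arg_G c eqn hG a
      rw [hb] at h; exact hvc b h.symm
    · rw [dif_neg hkG]
      by_cases hk : k ∈ C.xorPart
      · rw [dif_pos hk, ← C.card_orientWires_eq eqn hodd ⟨k, hk, hkG⟩ hv]
        congr 1
        exact filter_congr fun a _ => by rw [C.reorient_arg_U c eqn hG hk hkG, hsub]
      · rw [dif_neg hk]
        congr 1
        exact filter_congr fun a _ => by rw [C.reorient_arg_A c eqn hG hk, hsub]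
  rw [sum_congr rfl fun k _ => hterm k]
  -- notation for the two summands
  set T : Fin C.m → ℕ := fun k => if hkG : k = G then 0 else if hk : k ∈ C.xorPart then
      (univ.filter fun a : Fin 2 => C.arg (C.eqnOf eqn ⟨k, hk, hkG⟩) a = v).card
      else (univ.filter fun a : Fin 2 => C.arg k a = v).card with hT
  set t : Fin C.m → ℕ := fun k => (univ.filter fun a : Fin 2 => C.arg k a = v).card with ht
  let g : C.xorPart → ℕ := fun e => t e
  -- split both sums along the xor-part
  have hKeq : (univ.filter fun k : Fin C.m => k ∈ C.xorPart) = C.xorPart := by ext k; simp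
  rw [← sum_filter_add_sum_filter_not univ (fun k => k ∈ C.xorPart) T,
    ← sum_filter_add_sum_filter_not univ (fun k => k ∈ C.xorPart) t, hKeq]
  -- outside the xor-part the summands agree
  have hA : ∑ k ∈ univ.filter (fun k : Fin C.m => k ∉ C.xorPart), T k =
      ∑ k ∈ univ.filter (fun k : Fin C.m => k ∉ C.xorPart), t k := by
    refine sum_congr rfl fun k hk => ?_
    rw [mem_filter] at hk
    rw [hT, ht]
    simp only
    rw [dif_neg (fun h : k = G => hk.2 (h ▸ hG)), dif_neg hk.2]
  -- inside: the unknowns' equations are all equations but `i`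
  have hKT : ∑ k ∈ C.xorPart, T k = ∑ u : C.UIdx G, g (eqn u).1 := by
    rw [← sum_erase C.xorPart (f := T) (a := G) (by rw [hT]; simp)]
    rw [sum_subtype (C.xorPart.erase G) (p := fun k => k ∈ C.xorPart ∧ k ≠ G) (fun k => by simp [mem_erase, and_comm])]
    refine sum_congr rfl fun u _ => ?_
    rw [hT]; simp only
    rw [dif_neg u.2.2, dif_pos u.2.1]
  have hKt : ∑ k ∈ C.xorPart, t k = ∑ e ∈ (univ : Finset C.xorPart).erase i, g e + g i := by
    rw [sum_erase_add _ _ (mem_univ i), Finset.sum_coe_sort C.xorPart t]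
  have hequiv : ∑ u : C.UIdx G, g (eqn u).1 = ∑ e ∈ (univ : Finset C.xorPart).erase i, g e := by
    rw [Fintype.sum_equiv eqn (fun u => g (eqn u).1) (fun e => g e.1) (fun u => rfl)]
    rw [← sum_subtype ((univ : Finset C.xorPart).erase i) (p := fun e : C.xorPart => e ≠ i) (fun e => by simp)]
  have hgi : g i = (univ.filter fun a : Fin 2 => C.arg i a = v).card := rfl
  rw [hA, hKT, hKt, hequiv, hgi]
  omega

/-! ### Deleting `G`; accounting -/

variable {m' : ℕ} (ε : Fin m' ≃ {k : Fin C.m // k ≠ G})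

/-- Troubled gates of the new circuit come from gates of the acyclic part with the same wires
and function. [folklore] -/
theorem troubled_resynth_imp {k' : Fin m'} (hT' : ((C.reorient c eqn hG).removeGate G ε).Troubled k') :
    (ε k' : Fin C.m) ∉ C.xorPart ∧ ((C.reorient c eqn hG).removeGate G ε).op k' = C.op (ε k') ∧
      ∀ a, ((C.reorient c eqn hG).removeGate G ε).arg k' a = ((C.arg (ε k') a)).skip G ε ∧
        ∀ j, ((C.reorient c eqn hG).removeGate G ε).arg k' a = .var j ↔ C.arg (ε k') a = .var j := by
  obtain ⟨hand, -, x, y, -, hr, -, -⟩ := hT'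
  have hkG : (ε k' : Fin C.m) ≠ G := (ε k').2
  have hk : (ε k' : Fin C.m) ∉ C.xorPart := by
    intro hk
    have hop : ((C.reorient c eqn hG).removeGate G ε).op k' = (C.reorient c eqn hG).op (ε k') := rfl
    rw [hop, C.reorient_op_U c eqn hG hk hkG] at hand
    exact IsAndOp.not_isXorOp hand ⟨_, fun a b => rfl⟩
  refine ⟨hk, ?_, fun a => ?_⟩
  · show (C.reorient c eqn hG).op (ε k') = _; exact C.reorient_op_A c eqn hG hk
  · have harg : ((C.reorient c eqn hG).removeGate G ε).arg k' a = (C.substG G c (C.arg (ε k') a)).skip G ε := by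
      rw [removeGate_arg, C.reorient_arg_A c eqn hG hk]
    -- the wire is a variable (troubled), so `substG` did nothing
    have hvar : ∃ j, ((C.reorient c eqn hG).removeGate G ε).arg k' a = .var j := by
      have hmem : ((C.reorient c eqn hG).removeGate G ε).arg k' a ∈ Set.range (((C.reorient c eqn hG).removeGate G ε).arg k') :=
        ⟨a, rfl⟩
      rw [hr] at hmem
      rcases hmem with h | h
      · exact ⟨x, h⟩
      · exact ⟨y, h⟩
    obtain ⟨j, hj⟩ := hvar
    have hCj : C.arg (ε k') a = .var j := by
      rw [harg, Node.skip_eq_var_iff, C.substG_eq_var_iff] at hj; exact hj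
    refine ⟨by rw [harg, hCj]; rfl, fun j' => ?_⟩
    rw [harg, Node.skip_eq_var_iff, C.substG_eq_var_iff]

/-- Out-degrees in the new circuit: variables and gates of the acyclic part lose exactly the
wires of the dropped equation. [cite: LiYang2022, §4.1 (Case 0.3)] -/
theorem fanout_resynth_add (hodd : ∀ u, C.klin G (fun u' => decide (u' = u)) (eqn u) = true)
    {v : Node n C.m} (hv : ∀ k ∈ C.xorPart, v ≠ .gate k) (hvc : ∀ b, v ≠ .const b) :
    ((C.reorient c eqn hG).removeGate G ε).fanout (v.skip G ε) + (univ.filter fun a : Fin 2 => C.arg i a = v).card =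
      C.fanout v := by
  have h0 := C.reorient_not_reads c eqn hG
  have h1 := (C.reorient c eqn hG).fanout_removeGate_of_not_read G ε h0 (v := v) (hv G hG) fun a => by
    obtain ⟨b, hb⟩ := C.reorient_arg_G c eqn hG a; rw [hb]; exact fun h => hvc b h.symm
  rw [h1]
  exact C.fanout_reorient_add c eqn hG hodd hv hvc

/-- **New troubled gates of the new circuit are caused by the wires of the dropped equation.**
[cite: LiYang2022, §4.1 (Case 0.3), Lemma 3.11] -/
theorem causedBy_of_new_troubled_resynth (hodd : ∀ u, C.klin G (fun u' => decide (u' = u)) (eqn u) = true)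
    {k' : Fin m'} (hT' : ((C.reorient c eqn hG).removeGate G ε).Troubled k') (hT : ¬ C.Troubled (ε k')) :
    ∃ a, CausedBy C ((C.reorient c eqn hG).removeGate G ε) (fun k => (ε k : Fin C.m)) (C.arg i a) k' := by
  classical
  obtain ⟨hk, hop, hargs⟩ := C.troubled_resynth_imp c eqn hG ε hT'
  by_contra hno
  push Not at hno
  obtain ⟨hand, hf1, x, y, hxy, hr, hx, hy⟩ := hT'
  -- wires in `C`
  have hrC : Set.range (C.arg (ε k')) = {Node.var x, Node.var y} := by
    rw [← range_arg_removeGate_eq_pair_iff (ε := ε) (k₀ := G)]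
    convert hr using 2
    funext a; exact ((hargs a).1).symm
  have hxr : ∃ a', C.arg (ε k') a' = .var x := by
    have : (Node.var x : Node n C.m) ∈ Set.range (C.arg (ε k')) := by rw [hrC]; simp
    exact this
  have hyr : ∃ a', C.arg (ε k') a' = .var y := by
    have : (Node.var y : Node n C.m) ∈ Set.range (C.arg (ε k')) := by rw [hrC]; simp
    exact this
  -- no wire of `i` goes to `x` or `y` (else caused), nor to the acyclic gate `ε k'`
  have hno' : ∀ z, (∃ a', C.arg (ε k') a' = .var z) → ∀ a, C.arg i a ≠ .var z := by
    intro z ⟨a', ha'⟩ a h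
    exact hno a (Or.inr ⟨z, h, a', ((hargs a').2 z).mpr ha'⟩)
  have hfx := C.fanout_resynth_add c eqn hG ε hodd (v := .var x) (fun k _ h => by cases h) (fun b h => by cases h)
  have hfy := C.fanout_resynth_add c eqn hG ε hodd (v := .var y) (fun k _ h => by cases h) (fun b h => by cases h)
  have hfk := C.fanout_resynth_add c eqn hG ε hodd (v := .gate (ε k' : Fin C.m))
    (fun k hkK h => hk ((Node.gate.inj h) ▸ hkK)) (fun b h => by cases h)
  rw [filter_eq_empty_iff.mpr (fun a _ => hno' x hxr a), card_empty, add_zero, Node.skip_var] at hfx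
  rw [filter_eq_empty_iff.mpr (fun a _ => hno' y hyr a), card_empty, add_zero, Node.skip_var] at hfy
  rw [filter_eq_empty_iff.mpr (fun a _ h => hk (C.mem_of_arg_eq i i.2 a _ h)), card_empty, add_zero,
    Node.skip_gate_coe] at hfk
  apply hT
  refine ⟨hop ▸ hand, ?_, x, y, hxy, hrC, ?_, ?_⟩
  · rw [← hfk]; exact hf1
  · rw [← hfx]; exact hx
  · rw [← hfy]; exact hy

/-- **Accounting of the re-synthesis**: `Φ' ≤ Φ + 2` for a suitable packing ("a gate is removed
while `ΔΦ ≤ 2`", Case 0.3). [cite: LiYang2022, §4.1 (Case 0.3), Lemma 3.11] -/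
theorem exists_packing_resynth (hodd : ∀ u, C.klin G (fun u' => decide (u' = u)) (eqn u) = true)
    {P : Finset (Fin C.m × Fin C.m)} (hP : C.IsPacking P) :
    ∃ P' : Finset (Fin m' × Fin m'), ((C.reorient c eqn hG).removeGate G ε).IsPacking P' ∧
      ((C.reorient c eqn hG).removeGate G ε).potential P' ≤ C.potential P + 2 := by
  classical
  let C' := (C.reorient c eqn hG).removeGate G ε
  let ι : Fin m' → Fin C.m := fun k => (ε k : Fin C.m)
  have hιinj : Function.Injective ι := fun k k' h => ε.injective (Subtype.ext h)
  have hGT : ¬ C.Troubled G := fun ⟨hand, _⟩ => IsAndOp.not_isXorOp hand (C.isXorOp_of_mem G hG)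
  have himg : ∀ p ∈ P, (∃ k, ι k = p.1) ∧ ∃ k, ι k = p.2 := by
    intro p hp
    obtain ⟨-, hT1, hT2, -⟩ := hP.1 p hp
    exact ⟨⟨ε.symm ⟨p.1, fun h => hGT (h ▸ hT1)⟩, by simp [ι]⟩, ⟨ε.symm ⟨p.2, fun h => hGT (h ▸ hT2)⟩, by simp [ι]⟩⟩
  have hadj : ∀ k k', C'.Troubled k → C'.Troubled k' → C.Troubled (ι k) → C.Troubled (ι k') →
      C.Adjacent (ι k) (ι k') → C'.Adjacent k k' := by
    intro k k' hk hk' _ _ ⟨z, ⟨a, ha⟩, ⟨a', ha'⟩⟩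
    obtain ⟨-, -, hargs⟩ := C.troubled_resynth_imp c eqn hG ε hk
    obtain ⟨-, -, hargs'⟩ := C.troubled_resynth_imp c eqn hG ε hk'
    exact ⟨z, ⟨a, ((hargs a).2 z).mpr ha⟩, ⟨a', ((hargs' a').2 z).mpr ha'⟩⟩
  let A : Fin 2 → Finset (Fin m') := fun a => univ.filter fun k => C'.Troubled k ∧ CausedBy C C' ι (C.arg i a) k
  have hgood : ∀ a, C'.GoodCover (A a) := fun a =>
    goodCover_causedBy C C' ι hιinj _ (A a) fun k hk => (mem_filter.mp hk).2
  have hcover : ∀ k, C'.Troubled k → ¬ C.Troubled (ι k) → k ∈ A 0 ∨ k ∈ A 1 := by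
    intro k hk hkT
    obtain ⟨a, ha⟩ := C.causedBy_of_new_troubled_resynth c eqn hG ε hodd hk hkT
    rcases fin2_eq_or_eq_rev' a with rfl | rfl
    · exact Or.inl (mem_filter.mpr ⟨mem_univ _, hk, ha⟩)
    · exact Or.inr (mem_filter.mpr ⟨mem_univ _, hk, ha⟩)
  obtain ⟨P', hP', hpot⟩ := exists_packing_transfer C C' ι hιinj hP himg hadj (A 0) (A 1) hcover (hgood 0) (hgood 1)
  refine ⟨P', hP', hpot.trans ?_⟩
  have h0 : ((if A 0 = ∅ then 0 else 1 : ℕ) : ℝ) ≤ 1 := by exact_mod_cast ite_empty_le_one (A 0)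
  have h1 : ((if A 1 = ∅ then 0 else 1 : ℕ) : ℝ) ≤ 1 := by exact_mod_cast ite_empty_le_one (A 1)
  linarith
where
  /-- `Fin 2 = {0, 1}`. -/
  fin2_eq_or_eq_rev' : ∀ a : Fin 2, a = 0 ∨ a = 1 := by decide

end Reorient

/-! ### The theorem -/

section Main

variable {C}
variable {f : (Fin n → ZMod 2) → Bool} {R : RdqSource n} {d : ℕ} {αφ αI : ℝ} {P : Finset (Fin C.m × Fin C.m)}

/-- **A gate computing a constant on every solution is not the output** when the circuit computes
an affine disperser for dimension `d` on a source of dimension `≥ 2d`. [cite: LiYang2022, §4.1 (Case 0.3)] -/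
theorem out_ne_of_semConst (hf : IsAffineDisperser f d) (hd : 2 * d ≤ R.dim) (hF : C.Fair) (hC : C.ComputesRestr f R)
    {G : Fin C.m} {c : Bool} (hconst : ∀ (x : Fin n → Bool) (w : Fin C.m → Bool), C.Consistent x w → w G = c) :
    C.out ≠ .gate G := by
  intro hout
  obtain ⟨u, hu, v, hv, huv⟩ := hf.exists_ne_of_sol R hd
  have key : ∀ u ∈ R.Sol, f u = c := by
    intro u hu
    obtain ⟨w, hw, -⟩ := hF (boolOfZMod2.symm u)
    rw [← hC.2 u hu w hw, hout]
    exact hconst _ w hw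
  exact huv ((key u hu).trans (key v hv).symm)

/-- **Case 0.3 for a gate of the cyclic xor-part** (Li–Yang §4.1: "if there is a gate `G`
outputing a fixed constant `c` for any assignment to the variables, we directly replace it by `c`
… a gate is removed while `ΔΦ ≤ 2`, which means that `Δμ ≥ 1 - 2α_φ ≥ 0`"), made correct for the
cyclic part by re-synthesising the xor-part around `G := c` (module docstring): one gate fewer,
fair, computing `f|_R`, with a packing, `μ' ≤ μ - (1 - 2α_φ)`. [cite: LiYang2022, §4.1 (Case 0.3), Lemma 3.11] -/
theorem resynth_const_xorGate (hf : IsAffineDisperser f d) (hd : 2 * d ≤ R.dim) (hF : C.Fair)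
    (hC : C.ComputesRestr f R) (hP : C.IsPacking P) (hφ : 0 ≤ αφ) (hI : 0 ≤ αI) (αQ : ℝ)
    {G : Fin C.m} (hG : G ∈ C.xorPart) {c : Bool}
    (hconst : ∀ (x : Fin n → Bool) (w : Fin C.m → Bool), C.Consistent x w → w G = c) :
    ∃ (C' : Semicircuit n) (P' : Finset (Fin C'.m × Fin C'.m)), C'.Fair ∧ C'.ComputesRestr f R ∧
      C'.IsPacking P' ∧ C'.m + 1 = C.m ∧
      C'.measure αφ αI αQ P' R ≤ C.measure αφ αI αQ P R - (1 - 2 * αφ) := by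
  classical
  have hout : C.out ≠ .gate G := out_ne_of_semConst hf hd hF hC hconst
  obtain ⟨i, eqn, huniq, hodd⟩ := C.exists_orientation (G := G) (c := c) hF hG hconst
  let D := C.reorient c eqn hG
  have hcons := C.consistent_reorient_iff c eqn hG hF hconst huniq hodd
  have hFD : D.Fair := C.fair_reorient c eqn hG hF hconst huniq hodd
  have h0 := C.reorient_not_reads c eqn hG
  have hCD : D.ComputesRestr f R := by
    refine ⟨fun j hj => ?_, fun u hu w hw => ?_⟩
    · have h1 := hC.1 j hj
      have h2 := C.fanout_reorient_add c eqn hG hodd (v := .var j) (fun k _ h => by cases h) (fun b h => by cases h)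
      change D.fanout (.var j) + _ = _ at h2
      omega
    · rw [hcons] at hw
      have : D.nodeVal (boolOfZMod2.symm u) w D.out = C.nodeVal (boolOfZMod2.symm u) w C.out := by
        show D.nodeVal _ w C.out = _; cases C.out <;> rfl
      rw [this]; exact hC.2 u hu w hw
  let ε := D.skipEquiv G
  obtain ⟨P', hP', hpot⟩ := C.exists_packing_resynth c eqn hG ε hodd hP
  refine ⟨D.removeGate G ε, P', hFD.removeGate ε h0, hCD.removeGate ε hFD h0 hout, hP', D.removeGate_m_add_one G ε, ?_⟩
  have hinf : (((D.removeGate G ε).influential R).card : ℝ) ≤ (C.influential R).card := by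
    have hsub : (D.removeGate G ε).influential R ⊆ C.influential R := by
      intro j hj
      unfold influential at hj ⊢
      rw [mem_filter] at hj ⊢
      refine ⟨mem_univ _, hj.2.imp_left fun h => ?_⟩
      have := C.fanout_resynth_add c eqn hG ε hodd (v := .var j) (fun k _ h => by cases h) (fun b h => by cases h)
      rw [Node.skip_var] at this
      change (D.removeGate G ε).fanout (.var j) + _ = _ at this
      omega
    exact_mod_cast card_le_card hsub
  have hm : (((C.m - 1 : ℕ)) : ℝ) + 1 = C.m := by exact_mod_cast D.removeGate_m_add_one G ε
  unfold measure
  show ((C.m - 1 : ℕ) : ℝ) + _ + _ + _ ≤ _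
  nlinarith [mul_le_mul_of_nonneg_left hinf hI, mul_le_mul_of_nonneg_left hpot hφ]

end Main

end Semicircuit

end Literature.Computability.Complexity
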